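import Mathlib

/-!
# Fractional clique decompositions of dense graphs (Montgomery 2019)

A graph `G` has a FRACTIONAL `K_r`-DECOMPOSITION if the copies of `K_r` in `G` can be weighted non-negatively so that every
edge of `G` lies in copies of total weight exactly `1`. Writing `δ*_{K_r}` for the asymptotic minimum-degree threshold forcing
such a decomposition, Montgomery proved `δ*_{K_r} ≤ 1 − 1/(100r)` for every `r ≥ 4`, the first bound with the correct order
of dependence on `r` (Turán graphs show `δ*_{K_r} ≥ 1 − 1/(r+1)`; earlier bounds: Yuster `1 − 1/(9r^{10})`, Dukes
`1 − 2/(9r²(r−1)²)`, Barber–Kühn–Lo–Montgomery–Osthus `1 − 1/(10⁴ r^{3/2})`). The theorem is stated for ALL graphs (no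
largeness assumption) with vertex set `Fin n`, minimum degree as a bound on every `SimpleGraph.degree`, and `r`-cliques as
`SimpleGraph.IsNClique r`.

This file records the statement as a NAMED FACT (`def … : Prop`, D-0014); it is used conditionally by
`Summits/PneNP/PneNP/Theorems/ConvexRankGatesConvexGateBlindL1Montgomery.lean` (the ℓ₁-constant of clique-non-negative
weightings). Deliberately NOT here: the exact `F`-decomposition corollary (Glock–Kühn–Lo–Montgomery–Osthus), hypergraph
versions, and the proof. [cite: Montgomery2018, Theorem 1.3]
-/

namespace Literature.Combinatorics.SimpleGraph

/-- **Montgomery's fractional clique decomposition theorem** (Montgomery 2019, *Fractional clique decompositions of dense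
graphs*, Random Structures & Algorithms 54(4), Theorem 1.3). For each `r ≥ 4`, any graph `G` on `n` vertices with minimum
degree at least `(1 − 1/(100r))·n` has a fractional `K_r`-decomposition: a non-negative weighting `ω` of vertex sets,
supported on the `r`-cliques of `G`, such that for every edge `xy` of `G` the `r`-sets containing both `x` and `y` have total
weight exactly `1`. [cite: Montgomery2018, Theorem 1.3] -/
def MontgomeryFractionalCliqueDecomposition : Prop :=
  ∀ (r n : ℕ), 4 ≤ r → ∀ (G : _root_.SimpleGraph (Fin n)) [DecidableRel G.Adj],
    (∀ v : Fin n, (1 - 1 / (100 * (r : ℝ))) * n ≤ (G.degree v : ℝ)) →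
    ∃ ω : Finset (Fin n) → ℝ, (∀ S, 0 ≤ ω S) ∧ (∀ S, ω S ≠ 0 → G.IsNClique r S) ∧
      ∀ x y : Fin n, G.Adj x y →
        ∑ S ∈ (Finset.univ : Finset (Fin n)).powersetCard r, (if x ∈ S ∧ y ∈ S then ω S else 0) = 1

end Literature.Combinatorics.SimpleGraph
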